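import Summits.BirchSwinnertonDyer.BirchSwinnertonDyer.Theorems.SignedLowerHalvesSmallImageLowerHalfBothSignsRttF1DirichletBridge
import Summits.BirchSwinnertonDyer.BirchSwinnertonDyer.Theorems.SignedLowerHalvesSmallImageLowerHalfBothSignsRttF1ConjReindex
import Literature.NumberTheory.GaloisRepresentations.PadicEmbeddingZpTowerFrame
import HarnessLib

/-!
# F1 → THE MATCH: Kato's value law in `hV` shape, ψ̄-free (the (D-cyc) + (D-conj) bridge assembled)

Summit `BirchSwinnertonDyer`, crux `SmallImageLowerHalfBothSigns` (stmt-23599), line `rtt_w3`, stub S4‴ `stub_junctionRecipValues_ns`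
(LEAD rulings «(V)→hV bridge = honda» and «(F) = (α)», 2026-08-31). Namespace `…Theorems.SmallImageRttF1Bridge`. THEOREMS ONLY.

`prop159_values_inert_dirichlet_of_isGrossencharakter` (the (D-cyc) half) states Kato's value law (15.9.1) for the `p`-power-order Dirichlet
characters `χ mod p^{n+e₀}` with the depleted series `Σ_{(𝔟,p𝔣)=1} ψ̄(𝔟)·χ(N𝔟)·N𝔟^{−s}`; THE MATCH (`SmallImageRttReciprocity.hval_core`) shares ONE
series predicate `Lser` with the Mazur–Tate side, whose coefficients are `ψ(𝔟)·χ(N𝔟)` (`exists_period_transport_rayClass`). Under CM-REALITY of `ψ`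
(`ψ(c • w) = \overline{ψ(w)}` off `𝔪`, `c • 𝔣 = 𝔣`; in the crux these follow from the reality of the Hecke eigenvalues of the conjugate CM newform,
tree fact `ModularForms.DiamondShurman2005_thm554_isNewform0_gamma0_cuspCoeff_conj`) the two series coincide
(`tsum_conj_idealPow_eq_tsum_idealPow`), whence:

* ★★ `prop159_values_inert_hV_of_isGrossencharakter` — the fact with (V) in EXACTLY the shape of `hval_core`'s `hV` (`m + 1 := n`, `CK := Ω⁻¹`,
  `Na := N𝔞`, `e B := ψ(𝔞)` by `SmallImageRttD2FrameNsub.exists_isUnit_absNorm_sub_of_isUnit_phi0_nsub`, `Lser m χ′ Λ :↔ ∀ s, 3/2 < re s →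
  Λ s = Σ'_{(𝔟,p𝔣)=1} ψ(𝔟)·χ′⁻¹(N𝔟)·N𝔟^{−s}`), (P) verbatim.

References: [Kato2004Asterisque] Prop. 15.9, (15.9.1); [SilvermanATAEC1994] Ch. II Ex. 2.30; [DiamondShurman2005] Thm. 5.5.4; [MazurTateTeitelbaum1986Invent] §I.13.
-/

-- the Theorems namespace of this sub repeats the summit name by design (D-0017 nested layout)
set_option linter.dupNamespace false

noncomputable section

open scoped Classical NumberField ComplexConjugate Pointwise
open NumberField IsDedekindDomain Field Polynomial

namespace Summit.BirchSwinnertonDyer.BirchSwinnertonDyer.Theorems.SmallImageRttF1Bridge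

open Literature.NumberTheory.EllipticCurves Literature.NumberTheory.EllipticCurves.AcSigned
  Literature.NumberTheory.EllipticCurves.Kobayashi2003
  Literature.NumberTheory.GaloisRepresentations Literature.NumberTheory.GaloisRepresentations.DiscreteGaloisModule
  Literature.NumberTheory.GaloisCohomology Literature.NumberTheory.LFunctions
  Literature.NumberTheory.ComplexMultiplication.EllipticUnits
  Literature.NumberTheory.ComplexMultiplication.EllipticUnits.JohnsonLeungKings2011
  Literature.NumberTheory.EllipticCurves.Kato2004 Literature.NumberTheory.EllipticCurves.Kato2004.CM
  Literature.NumberTheory.EllipticCurves.Kato2004.LocalTate ZpExtension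

variable {K : Type} [Field K] [NumberField K]

/-- The depletion modulus `p·𝔣` is `c`-stable when `𝔣` is (`c` fixes `p ∈ ℤ`). [cite: Kato2004Asterisque, §15.5 (p. 253)] -/
theorem smul_katoModulus (c : K ≃ₐ[ℚ] K) (p : ℕ) {𝔣 : Ideal (𝓞 K)} (h𝔣 : c • 𝔣 = 𝔣) (s : ℕ) : c • katoModulus p 𝔣 s = katoModulus p 𝔣 s := by
  have hp : c • (Ideal.span {((p : ℕ) : 𝓞 K)} : Ideal (𝓞 K)) = Ideal.span {((p : ℕ) : 𝓞 K)} := by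
    have h1 : c • ((p : ℕ) : 𝓞 K) = ((p : ℕ) : 𝓞 K) := map_natCast (MulSemiringAction.toRingHom (K ≃ₐ[ℚ] K) (𝓞 K) c) p
    rw [Ideal.smul_closure, Set.smul_set_singleton, h1]
  rw [katoModulus, Ideal.pointwise_smul_def, Ideal.map_mul, Ideal.map_pow, ← Ideal.pointwise_smul_def, ← Ideal.pointwise_smul_def, hp, h𝔣]

set_option maxHeartbeats 1600000 in
/-- ★★ **F1 in `hV` shape, ψ̄-free (the (V)→hV bridge of THE MATCH).** `prop159_values_inert_dirichlet_of_isGrossencharakter` with the depleted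
series rewritten, under CM-reality of `ψ` off `𝔪` for an automorphism `c` of `K` fixing `𝔣`, from coefficients `ψ̄(𝔟)·χ(N𝔟)` to `ψ(𝔟)·χ(N𝔟)`
(`tsum_conj_idealPow_eq_tsum_idealPow` with `F(m) = χ(m)·m^{−s}`, `𝔠 = p𝔣 ⊆ 𝔪`, `c • 𝔠 = 𝔠`). Consumed by name in `S4‴_of_F1` as `hval_core`'s `hV`.
[cite: Kato2004Asterisque, Prop. 15.9 and (15.9.1) (pp. 258–259)] [cite: SilvermanATAEC1994, Ch. II Ex. 2.30] [cite: MazurTateTeitelbaum1986Invent, §I.13] -/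
theorem prop159_values_inert_hV_of_isGrossencharakter (hF : prop159_ellipticUnits_tatePairing_values_inert) :
  ∀ (K : Type) [Field K] [NumberField K] (σK : K →+* ℂ), Module.finrank ℚ K = 2 → IsTotallyComplex K →
  ∀ (p : ℕ) [Fact p.Prime], p ≠ 2 →
  ∀ (v : HeightOneSpectrum (𝓞 K)), v.asIdeal = Ideal.span {((p : ℕ) : 𝓞 K)} → ∀ (hpv : ((p : ℕ) : 𝓞 K) ∈ v.asIdeal),
  ∀ (κ : ZpExtension K p), κ.IsCyclotomic → ∀ (hvns : IsNonsplitIn κ v),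
  ∀ (γv : absoluteGaloisGroup (v.adicCompletion K)), (localizeAt κ v hvns).IsTopGenerator γv →
    -- (THE MATCH's normalisation, see `isCyclotomicVariable_absGaloisRestrict_of_isTopGenerator`)
    IsCyclotomicVariable p (absGaloisRestrict ℚ K (resGalOfEmb (closureEmb (K := K) (v.adicCompletion K)) γv)) →
  ∀ (𝔪 : Ideal (𝓞 K)) (h𝔪 : 𝔪 ≠ ⊥) (ψ : HeightOneSpectrum (𝓞 K) → ℂ) (hψ : IsGrossencharakter 𝔪 (embType σK) (embTypeConj σK) ψ),
  ∀ (𝔣 : Ideal (𝓞 K)), 𝔣 ≠ ⊥ → (∀ u : (𝓞 K)ˣ, (u : 𝓞 K) - 1 ∈ 𝔣 → u = 1) →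
    𝔪 ∣ 𝔣 →
  -- NEW (CM-REALITY, LEAD ruling «(F) = (α)»): an automorphism `c` of `K` with `ψ(c • w) = conj (ψ w)` off `𝔪` and `c • 𝔣 = 𝔣`
  ∀ (cK : K ≃ₐ[ℚ] K), (∀ w : HeightOneSpectrum (𝓞 K), ¬ 𝔪 ≤ w.asIdeal → ψ (cK • w) = conj (ψ w)) → cK • 𝔣 = 𝔣 →
  ∀ (S : Set (PadicAlgCl p)), FiniteDimensional ℚ_[p] (padicCoeffField S) →
  ∀ (θ : FramedGaloisRep K (padicCoeffIntegers S) 1) (θ' : absoluteGaloisGroup K →ₜ* (padicCoeffIntegers S)ˣ),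
    (∀ g : absoluteGaloisGroup K, ((θ' g : (padicCoeffIntegers S)ˣ) : padicCoeffIntegers S) *
      ((θ g : GL (Fin 1) (padicCoeffIntegers S)) : Matrix (Fin 1) (Fin 1) (padicCoeffIntegers S)) 0 0 = 1) →
  ∀ (e : PadicAlgCl p ≃+* ℂ),
    (∀ w : HeightOneSpectrum (𝓞 K), IsCoprime w.asIdeal (katoModulus p 𝔣 1) →
      θ.IsUnramifiedAt w ∧ ∃ P : Polynomial (padicCoeffIntegers S),
        P.map (padicCoeffIntegers S).subtype = Polynomial.X - Polynomial.C (e.symm (ψ w)) ∧ θ.HasFrobCharpolyAt w P) →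
  ∀ (ιC : AlgebraicClosure K →+* ℂ), (∀ x : K, ιC (algebraMap K (AlgebraicClosure K) x) = σK x) →
  ∀ (Φ : AlgebraicClosure (v.adicCompletion K) →+* PadicAlgCl p),
    (letI := LocalField.adicCompletionPadicAlgebra v p hpv
     ∀ y : ℚ_[p], Φ (algebraMap (v.adicCompletion K) (AlgebraicClosure (v.adicCompletion K)) (algebraMap ℚ_[p] (v.adicCompletion K) y)) =
       algebraMap ℚ_[p] (PadicAlgCl p) y) →
    (∀ x : AlgebraicClosure K, (∀ σ ∈ κ.kerSubgroup, σ • x = x) →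
      e (Φ (closureEmb (K := K) (v.adicCompletion K) x)) = ιC x) →
  ∀ (W : WeierstrassCurve ℚ) [W.IsElliptic] [W.IsGloballyMinimal], W.HasGoodReductionAtPrime p → W.frobeniusTrace p = 0 →
  ∀ [DistribMulAction (absoluteGaloisGroup (v.adicCompletion K)) (GreenbergSelmer.Cofree θ (padicCoeffField S))]
    (hres : ∀ (σ : absoluteGaloisGroup (v.adicCompletion K)) (m : GreenbergSelmer.Cofree θ (padicCoeffField S)),
      σ • m = resGalOfEmb (closureEmb (K := K) (v.adicCompletion K)) σ • m)
    (hstab : ∀ m : GreenbergSelmer.Cofree θ (padicCoeffField S),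
      IsOpen (MulAction.stabilizer (absoluteGaloisGroup (v.adicCompletion K)) m : Set (absoluteGaloisGroup (v.adicCompletion K))))
    (j : (W.baseChange K).geomPrimaryTorsion p →+ GreenbergSelmer.Cofree θ (padicCoeffField S)),
    (∀ (δ : absoluteGaloisGroup (v.adicCompletion K)) (t : (W.baseChange K).geomPrimaryTorsion p),
      j (resGalOfEmb (closureEmb (K := K) (v.adicCompletion K)) δ • t) = resGalOfEmb (closureEmb (K := K) (v.adicCompletion K)) δ • j t) →
    Submodule.span (padicCoeffIntegers S) (Set.range j) = ⊤ →
  ∃ (Ω : ℂ) (av : v.adicCompletion K) (aS : padicCoeffField S), Ω ≠ 0 ∧ av ≠ 0 ∧ aS ≠ 0 ∧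
  ∀ (𝔞 : Ideal (𝓞 K)), IsCoprime 𝔞 (katoModulus6 p 𝔣) → ∀ (n : ℕ), ∃ Y : ℕ → PadicAlgCl p,
    -- (V″) THE VALUE LAW (15.9.1) IN THE MATCH's CURRENCY, ψ̄-FREE: coefficients `ψ(𝔟)·χ(N𝔟)` (hMT's `rayClassLSeries` coefficients)
    (∀ (ζ : PadicAlgCl p) (χ : DirichletCharacter ℂ (p ^ (n + cyclotomicExponent p))), (∃ i : ℕ, orderOf χ = p ^ i) →
      χ (cyclotomicGenerator p : ZMod (p ^ (n + cyclotomicExponent p))) = e ζ →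
      ∀ Λ : ℂ → ℂ, Differentiable ℂ Λ →
        (∀ s : ℂ, 3 / 2 < s.re → Λ s =
          ∑' I : Ideal (𝓞 K), if IsCoprime I (katoModulus p 𝔣 1) then
            Literature.NumberTheory.LFunctions.idealPow K ψ I * χ ((Ideal.absNorm I : ℕ) : ZMod (p ^ (n + cyclotomicExponent p))) *
              ((Ideal.absNorm I : ℕ) : ℂ) ^ (-s) else 0) →
        e (∑ m ∈ Finset.range (p ^ n), ζ ^ m * Y m) =
          Ω⁻¹ * (((Ideal.absNorm 𝔞 : ℕ) : ℂ) - Literature.NumberTheory.LFunctions.idealPow K ψ 𝔞 *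
            (χ ((Ideal.absNorm 𝔞 : ℕ) : ZMod (p ^ (n + cyclotomicExponent p))))⁻¹) * Λ 1) ∧
    -- (P) THE PAIRING LAW at every torsion exponent `k` and every large Kato level `s` (VERBATIM the fact's)
    (∀ (k : ℕ), ∃ s₀ : ℕ, ∀ (s : ℕ), s₀ ≤ s → ∀ (hle : katoLevelSubgroup p 𝔣 s ≤ κ.layerSubgroup n)
      (u β : (AlgebraicClosure K)ˣ) (c : levelCohO S (suppPF p 𝔣) θ' (katoLevelSubgroup p 𝔣 s) k 1),
      IsKatoUnitRepAt p ιC 𝔣 s 𝔞 u → β ^ (p ^ k) = u⁻¹ → IsTwistedKummerClassO S θ' (suppPF p 𝔣) (katoLevelSubgroup p 𝔣 s) k β c →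
      ∀ [IsClosed ((localSubgroupOfEmb (κ.layerSubgroup n) (closureEmb (K := K) (v.adicCompletion K)) :
          Subgroup (absoluteGaloisGroup (v.adicCompletion K))) : Set (absoluteGaloisGroup (v.adicCompletion K)))]
        [Fintype (absoluteGaloisGroup (v.adicCompletion K) ⧸ localSubgroupOfEmb (κ.layerSubgroup n) (closureEmb (K := K) (v.adicCompletion K)))]
        (lam : padicCoeffIntegers S →+ ℤ_[p]), (∀ (c : ℤ_[p]) (y : padicCoeffIntegers S), lam (padicIntToCoeffIntegers S c * y) = c * lam y) →
      ∀ (Pk : ContPairing (locCoeffRep S θ' (suppPF p 𝔣) v k).toTopRep (torsRep (GreenbergSelmer.Cofree θ (padicCoeffField S)) p hstab k).toTopRep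
          (muAt K (p ^ k) v).toTopRep),
        (∀ (x : ↥(Representation.invariants ((muTwistO S θ' k).toRepresentation.comp (ramificationSubgroup K (suppPF p 𝔣)).subtype)))
            (a : padicCoeffIntegers S) (ζ : MuCarrier K (p ^ k)), (x : OMuCarrier K S (p ^ k)) = OMuCarrier.tmul a ζ →
            ∀ t : Fin 1 → padicCoeffIntegers S,
              Pk.toLin x (divPowTors S K θ k t) = zmodSMulMu K (p ^ k) ζ (lamZMod S lam k (a * t 0))) →
      ∀ (Q' Q : localPoints (W.baseChange K) (v.adicCompletion K)),
        Q' ∈ localLayerPointsOfEmb κ (closureEmb (K := K) (v.adicCompletion K)) (W.baseChange K) n →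
        Q' ∈ (W.baseChange K).localKernelOfReduction v → p ^ k • Q = Q' →
      ∀ (r : padicCoeffIntegers S)
        (φ : contOneCocycles (discreteTopRep (localSubgroupOfEmb (κ.layerSubgroup n) (closureEmb (K := K) (v.adicCompletion K)))
          ↥(torsionPow (GreenbergSelmer.Cofree θ (padicCoeffField S)) p k))),
        (∀ (τ : localSubgroupOfEmb (κ.layerSubgroup n) (closureEmb (K := K) (v.adicCompletion K))) (t : (W.baseChange K).geomPrimaryTorsion p),
          pointsMapOfEmb (W.baseChange K) (closureEmb (K := K) (v.adicCompletion K)) (t : (W.baseChange K).geomPoints) =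
              (τ : absoluteGaloisGroup (v.adicCompletion K)) • Q - Q →
            ((φ.1 τ : ↥(torsionPow (GreenbergSelmer.Cofree θ (padicCoeffField S)) p k)) : GreenbergSelmer.Cofree θ (padicCoeffField S)) = r • j t) →
      ∃ t : padicCoeffIntegers S,
        (haveI : NeZero (p ^ k) := ⟨pow_ne_zero _ (Fact.out : p.Prime).ne_zero⟩
         localPairingSubgroup K (p ^ k) v (locCoeffRep S θ' (suppPF p 𝔣) v k) (torsRep (GreenbergSelmer.Cofree θ (padicCoeffField S)) p hstab k) Pk
            (localSubgroupOfEmb (κ.layerSubgroup n) (closureEmb (K := K) (v.adicCompletion K)))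
            (locNK S κ θ' (suppPF p 𝔣) v n k
              (relCoresO S (suppPF p 𝔣) θ' hle (κ.isOpen_layerSubgroup n) (isOpen_absGaloisFixingSubgroup K (katoLayer p 𝔣 s)) k 1 c))
            (oneCocycleClass _ φ) = PadicInt.toZModPow k (lam (r * t))) ∧
        (t : PadicAlgCl p) =
          Φ (algebraMap (v.adicCompletion K) (AlgebraicClosure (v.adicCompletion K)) av) * ((aS : padicCoeffField S) : PadicAlgCl p) *
            ∑ m ∈ Finset.range (p ^ n), Y m *
              (∑' i : ℕ, algebraMap ℚ_[p] (PadicAlgCl p) (PowerSeries.coeff i (W.map (algebraMap ℚ ℚ_[p])).formalLog) *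
                Φ (WeierstrassCurve.Affine.Point.zCoord
                  (show ((W.baseChange K).baseChange (AlgebraicClosure (v.adicCompletion K))).toAffine.Point from (γv ^ m) • Q')) ^ i)) := by
  intro K _ _ σK hK2 htc p _ hp v hv hpv κ hκ hvns γv hγv hγcyc 𝔪 h𝔪 ψ hψ 𝔣 h𝔣 hunits h𝔪𝔣 cK hψc h𝔣c S hS θ θ' hθ'θ e hpin ιC hιC Φ hΦ hcoh
    W _ _ hgood hap _ hres hstab j hj hspan
  obtain ⟨Ω, av, aS, hΩ, hav, haS, hmain⟩ :=
    prop159_values_inert_dirichlet_of_isGrossencharakter hF K σK hK2 htc p hp v hv hpv κ hκ hvns γv hγv hγcyc 𝔪 h𝔪 ψ hψ 𝔣 h𝔣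
      hunits h𝔪𝔣 S hS θ θ' hθ'θ e hpin ιC hιC Φ hΦ hcoh W hgood hap hres hstab j hj hspan
  refine ⟨Ω, av, aS, hΩ, hav, haS, fun 𝔞 h𝔞 n ↦ ?_⟩
  obtain ⟨Y, hV, hP⟩ := hmain 𝔞 h𝔞 n
  refine ⟨Y, fun ζ χ hord hχζ Λ hΛd hΛs ↦ hV ζ χ hord hχζ Λ hΛd fun s hs ↦ ?_, hP⟩
  -- the depletion modulus `𝔠 = p𝔣`: `c`-stable, `⊆ 𝔪`, proper
  have h𝔠c : cK • katoModulus p 𝔣 1 = katoModulus p 𝔣 1 := smul_katoModulus cK p h𝔣c 1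
  have h𝔠𝔪 : katoModulus p 𝔣 1 ≤ 𝔪 := by rw [katoModulus]; exact Ideal.mul_le_left.trans (Ideal.le_of_dvd h𝔪𝔣)
  have h𝔠 : katoModulus p 𝔣 1 ≠ ⊤ := by
    intro h
    have hle : katoModulus p 𝔣 1 ≤ v.asIdeal := by
      rw [katoModulus, pow_one]; exact Ideal.mul_le_right.trans ((Ideal.span_singleton_le_iff_mem _).mpr hpv)
    rw [h, top_le_iff] at hle
    exact v.isPrime.ne_top hle
  rw [hΛs s hs]
  have key := tsum_conj_idealPow_eq_tsum_idealPow cK hψc h𝔠c h𝔠𝔪 h𝔠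
    (fun m : ℕ ↦ χ ((m : ℕ) : ZMod (p ^ (n + cyclotomicExponent p))) * ((m : ℕ) : ℂ) ^ (-s))
  simp only [mul_assoc] at key ⊢
  exact key.symm

set_option maxHeartbeats 1600000 in
/-- ★★ **F1 in `hV` shape with the `p`-adic frame PRODUCED** (consumes `PadicEmbedding.exists_frame_coherent_on_zpTower`, p827833): the same as
`prop159_values_inert_hV_of_isGrossencharakter` but taking only the complex frame `ιC ⊇ σK` and returning a `p`-adic frame `Φ : K̄_v → ℚ̄_p` over
`ℚ_p → K_v`, coherent with `ιC` through `e` on `K_∞`, for which (V″) and (P) hold. [cite: Kato2004Asterisque, Prop. 15.9 and (15.9.1) (pp. 258–259)]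
[cite: NeukirchANT1999, Ch. II §8 (8.2)–(8.3)] -/
theorem prop159_values_inert_hV_frame_of_isGrossencharakter (hF : prop159_ellipticUnits_tatePairing_values_inert) :
  ∀ (K : Type) [Field K] [NumberField K] (σK : K →+* ℂ), Module.finrank ℚ K = 2 → IsTotallyComplex K →
  ∀ (p : ℕ) [Fact p.Prime], p ≠ 2 →
  ∀ (v : HeightOneSpectrum (𝓞 K)), v.asIdeal = Ideal.span {((p : ℕ) : 𝓞 K)} → ∀ (hpv : ((p : ℕ) : 𝓞 K) ∈ v.asIdeal),
  ∀ (κ : ZpExtension K p), κ.IsCyclotomic → ∀ (hvns : IsNonsplitIn κ v),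
  ∀ (γv : absoluteGaloisGroup (v.adicCompletion K)), (localizeAt κ v hvns).IsTopGenerator γv →
    -- (THE MATCH's normalisation, see `isCyclotomicVariable_absGaloisRestrict_of_isTopGenerator`)
    IsCyclotomicVariable p (absGaloisRestrict ℚ K (resGalOfEmb (closureEmb (K := K) (v.adicCompletion K)) γv)) →
  ∀ (𝔪 : Ideal (𝓞 K)) (h𝔪 : 𝔪 ≠ ⊥) (ψ : HeightOneSpectrum (𝓞 K) → ℂ) (hψ : IsGrossencharakter 𝔪 (embType σK) (embTypeConj σK) ψ),
  ∀ (𝔣 : Ideal (𝓞 K)), 𝔣 ≠ ⊥ → (∀ u : (𝓞 K)ˣ, (u : 𝓞 K) - 1 ∈ 𝔣 → u = 1) →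
    𝔪 ∣ 𝔣 →
  -- NEW (CM-REALITY, LEAD ruling «(F) = (α)»): an automorphism `c` of `K` with `ψ(c • w) = conj (ψ w)` off `𝔪` and `c • 𝔣 = 𝔣`
  ∀ (cK : K ≃ₐ[ℚ] K), (∀ w : HeightOneSpectrum (𝓞 K), ¬ 𝔪 ≤ w.asIdeal → ψ (cK • w) = conj (ψ w)) → cK • 𝔣 = 𝔣 →
  ∀ (S : Set (PadicAlgCl p)), FiniteDimensional ℚ_[p] (padicCoeffField S) →
  ∀ (θ : FramedGaloisRep K (padicCoeffIntegers S) 1) (θ' : absoluteGaloisGroup K →ₜ* (padicCoeffIntegers S)ˣ),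
    (∀ g : absoluteGaloisGroup K, ((θ' g : (padicCoeffIntegers S)ˣ) : padicCoeffIntegers S) *
      ((θ g : GL (Fin 1) (padicCoeffIntegers S)) : Matrix (Fin 1) (Fin 1) (padicCoeffIntegers S)) 0 0 = 1) →
  ∀ (e : PadicAlgCl p ≃+* ℂ),
    (∀ w : HeightOneSpectrum (𝓞 K), IsCoprime w.asIdeal (katoModulus p 𝔣 1) →
      θ.IsUnramifiedAt w ∧ ∃ P : Polynomial (padicCoeffIntegers S),
        P.map (padicCoeffIntegers S).subtype = Polynomial.X - Polynomial.C (e.symm (ψ w)) ∧ θ.HasFrobCharpolyAt w P) →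
  -- ONE complex frame `ιC` of `K̄` extending `σK` (pins the elliptic units); the `p`-adic frame `Φ` is PRODUCED (`exists_frame_coherent_on_zpTower`)
  ∀ (ιC : AlgebraicClosure K →+* ℂ), (∀ x : K, ιC (algebraMap K (AlgebraicClosure K) x) = σK x) →
  ∀ (W : WeierstrassCurve ℚ) [W.IsElliptic] [W.IsGloballyMinimal], W.HasGoodReductionAtPrime p → W.frobeniusTrace p = 0 →
  ∀ [DistribMulAction (absoluteGaloisGroup (v.adicCompletion K)) (GreenbergSelmer.Cofree θ (padicCoeffField S))]
    (hres : ∀ (σ : absoluteGaloisGroup (v.adicCompletion K)) (m : GreenbergSelmer.Cofree θ (padicCoeffField S)),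
      σ • m = resGalOfEmb (closureEmb (K := K) (v.adicCompletion K)) σ • m)
    (hstab : ∀ m : GreenbergSelmer.Cofree θ (padicCoeffField S),
      IsOpen (MulAction.stabilizer (absoluteGaloisGroup (v.adicCompletion K)) m : Set (absoluteGaloisGroup (v.adicCompletion K))))
    (j : (W.baseChange K).geomPrimaryTorsion p →+ GreenbergSelmer.Cofree θ (padicCoeffField S)),
    (∀ (δ : absoluteGaloisGroup (v.adicCompletion K)) (t : (W.baseChange K).geomPrimaryTorsion p),
      j (resGalOfEmb (closureEmb (K := K) (v.adicCompletion K)) δ • t) = resGalOfEmb (closureEmb (K := K) (v.adicCompletion K)) δ • j t) →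
    Submodule.span (padicCoeffIntegers S) (Set.range j) = ⊤ →
  ∃ (Φ : AlgebraicClosure (v.adicCompletion K) →+* PadicAlgCl p),
    (letI := LocalField.adicCompletionPadicAlgebra v p hpv
     ∀ y : ℚ_[p], Φ (algebraMap (v.adicCompletion K) (AlgebraicClosure (v.adicCompletion K)) (algebraMap ℚ_[p] (v.adicCompletion K) y)) =
       algebraMap ℚ_[p] (PadicAlgCl p) y) ∧
    (∀ x : AlgebraicClosure K, (∀ σ ∈ κ.kerSubgroup, σ • x = x) → e (Φ (closureEmb (K := K) (v.adicCompletion K) x)) = ιC x) ∧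
  ∃ (Ω : ℂ) (av : v.adicCompletion K) (aS : padicCoeffField S), Ω ≠ 0 ∧ av ≠ 0 ∧ aS ≠ 0 ∧
  ∀ (𝔞 : Ideal (𝓞 K)), IsCoprime 𝔞 (katoModulus6 p 𝔣) → ∀ (n : ℕ), ∃ Y : ℕ → PadicAlgCl p,
    -- (V″) THE VALUE LAW (15.9.1) IN THE MATCH's CURRENCY, ψ̄-FREE: coefficients `ψ(𝔟)·χ(N𝔟)` (hMT's `rayClassLSeries` coefficients)
    (∀ (ζ : PadicAlgCl p) (χ : DirichletCharacter ℂ (p ^ (n + cyclotomicExponent p))), (∃ i : ℕ, orderOf χ = p ^ i) →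
      χ (cyclotomicGenerator p : ZMod (p ^ (n + cyclotomicExponent p))) = e ζ →
      ∀ Λ : ℂ → ℂ, Differentiable ℂ Λ →
        (∀ s : ℂ, 3 / 2 < s.re → Λ s =
          ∑' I : Ideal (𝓞 K), if IsCoprime I (katoModulus p 𝔣 1) then
            Literature.NumberTheory.LFunctions.idealPow K ψ I * χ ((Ideal.absNorm I : ℕ) : ZMod (p ^ (n + cyclotomicExponent p))) *
              ((Ideal.absNorm I : ℕ) : ℂ) ^ (-s) else 0) →
        e (∑ m ∈ Finset.range (p ^ n), ζ ^ m * Y m) =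
          Ω⁻¹ * (((Ideal.absNorm 𝔞 : ℕ) : ℂ) - Literature.NumberTheory.LFunctions.idealPow K ψ 𝔞 *
            (χ ((Ideal.absNorm 𝔞 : ℕ) : ZMod (p ^ (n + cyclotomicExponent p))))⁻¹) * Λ 1) ∧
    -- (P) THE PAIRING LAW at every torsion exponent `k` and every large Kato level `s` (VERBATIM the fact's)
    (∀ (k : ℕ), ∃ s₀ : ℕ, ∀ (s : ℕ), s₀ ≤ s → ∀ (hle : katoLevelSubgroup p 𝔣 s ≤ κ.layerSubgroup n)
      (u β : (AlgebraicClosure K)ˣ) (c : levelCohO S (suppPF p 𝔣) θ' (katoLevelSubgroup p 𝔣 s) k 1),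
      IsKatoUnitRepAt p ιC 𝔣 s 𝔞 u → β ^ (p ^ k) = u⁻¹ → IsTwistedKummerClassO S θ' (suppPF p 𝔣) (katoLevelSubgroup p 𝔣 s) k β c →
      ∀ [IsClosed ((localSubgroupOfEmb (κ.layerSubgroup n) (closureEmb (K := K) (v.adicCompletion K)) :
          Subgroup (absoluteGaloisGroup (v.adicCompletion K))) : Set (absoluteGaloisGroup (v.adicCompletion K)))]
        [Fintype (absoluteGaloisGroup (v.adicCompletion K) ⧸ localSubgroupOfEmb (κ.layerSubgroup n) (closureEmb (K := K) (v.adicCompletion K)))]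
        (lam : padicCoeffIntegers S →+ ℤ_[p]), (∀ (c : ℤ_[p]) (y : padicCoeffIntegers S), lam (padicIntToCoeffIntegers S c * y) = c * lam y) →
      ∀ (Pk : ContPairing (locCoeffRep S θ' (suppPF p 𝔣) v k).toTopRep (torsRep (GreenbergSelmer.Cofree θ (padicCoeffField S)) p hstab k).toTopRep
          (muAt K (p ^ k) v).toTopRep),
        (∀ (x : ↥(Representation.invariants ((muTwistO S θ' k).toRepresentation.comp (ramificationSubgroup K (suppPF p 𝔣)).subtype)))
            (a : padicCoeffIntegers S) (ζ : MuCarrier K (p ^ k)), (x : OMuCarrier K S (p ^ k)) = OMuCarrier.tmul a ζ →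
            ∀ t : Fin 1 → padicCoeffIntegers S,
              Pk.toLin x (divPowTors S K θ k t) = zmodSMulMu K (p ^ k) ζ (lamZMod S lam k (a * t 0))) →
      ∀ (Q' Q : localPoints (W.baseChange K) (v.adicCompletion K)),
        Q' ∈ localLayerPointsOfEmb κ (closureEmb (K := K) (v.adicCompletion K)) (W.baseChange K) n →
        Q' ∈ (W.baseChange K).localKernelOfReduction v → p ^ k • Q = Q' →
      ∀ (r : padicCoeffIntegers S)
        (φ : contOneCocycles (discreteTopRep (localSubgroupOfEmb (κ.layerSubgroup n) (closureEmb (K := K) (v.adicCompletion K)))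
          ↥(torsionPow (GreenbergSelmer.Cofree θ (padicCoeffField S)) p k))),
        (∀ (τ : localSubgroupOfEmb (κ.layerSubgroup n) (closureEmb (K := K) (v.adicCompletion K))) (t : (W.baseChange K).geomPrimaryTorsion p),
          pointsMapOfEmb (W.baseChange K) (closureEmb (K := K) (v.adicCompletion K)) (t : (W.baseChange K).geomPoints) =
              (τ : absoluteGaloisGroup (v.adicCompletion K)) • Q - Q →
            ((φ.1 τ : ↥(torsionPow (GreenbergSelmer.Cofree θ (padicCoeffField S)) p k)) : GreenbergSelmer.Cofree θ (padicCoeffField S)) = r • j t) →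
      ∃ t : padicCoeffIntegers S,
        (haveI : NeZero (p ^ k) := ⟨pow_ne_zero _ (Fact.out : p.Prime).ne_zero⟩
         localPairingSubgroup K (p ^ k) v (locCoeffRep S θ' (suppPF p 𝔣) v k) (torsRep (GreenbergSelmer.Cofree θ (padicCoeffField S)) p hstab k) Pk
            (localSubgroupOfEmb (κ.layerSubgroup n) (closureEmb (K := K) (v.adicCompletion K)))
            (locNK S κ θ' (suppPF p 𝔣) v n k
              (relCoresO S (suppPF p 𝔣) θ' hle (κ.isOpen_layerSubgroup n) (isOpen_absGaloisFixingSubgroup K (katoLayer p 𝔣 s)) k 1 c))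
            (oneCocycleClass _ φ) = PadicInt.toZModPow k (lam (r * t))) ∧
        (t : PadicAlgCl p) =
          Φ (algebraMap (v.adicCompletion K) (AlgebraicClosure (v.adicCompletion K)) av) * ((aS : padicCoeffField S) : PadicAlgCl p) *
            ∑ m ∈ Finset.range (p ^ n), Y m *
              (∑' i : ℕ, algebraMap ℚ_[p] (PadicAlgCl p) (PowerSeries.coeff i (W.map (algebraMap ℚ ℚ_[p])).formalLog) *
                Φ (WeierstrassCurve.Affine.Point.zCoord
                  (show ((W.baseChange K).baseChange (AlgebraicClosure (v.adicCompletion K))).toAffine.Point from (γv ^ m) • Q')) ^ i)) := by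
  intro K _ _ σK hK2 htc p _ hp v hv hpv κ hκ hvns γv hγv hγcyc 𝔪 h𝔪 ψ hψ 𝔣 h𝔣 hunits h𝔪𝔣 cK hψc h𝔣c S hS θ θ' hθ'θ e hpin ιC hιC
    W _ _ hgood hap _ hres hstab j hj hspan
  obtain ⟨Φ, hΦ, hcoh⟩ := PadicEmbedding.exists_frame_coherent_on_zpTower v hv hpv κ hvns σK e ιC hιC
  exact ⟨Φ, hΦ, hcoh, prop159_values_inert_hV_of_isGrossencharakter hF K σK hK2 htc p hp v hv hpv κ hκ hvns γv hγv hγcyc 𝔪 h𝔪 ψ hψ 𝔣 h𝔣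
    hunits h𝔪𝔣 cK hψc h𝔣c S hS θ θ' hθ'θ e hpin ιC hιC Φ hΦ hcoh W hgood hap hres hstab j hj hspan⟩

end Summit.BirchSwinnertonDyer.BirchSwinnertonDyer.Theorems.SmallImageRttF1Bridge

end
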